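import Summits.CriticalPhenomena.PercolationContinuityZ3.Theorems.PercNearOneGluingNoHeavyQuantLevelChainBounded
import Summits.CriticalPhenomena.PercolationContinuityZ3.Theorems.PercNearOneGluingNoHeavyQuantSqrtTrick
import HarnessLib

/-!
# QUANT lane, ERP glue: Kozma–Nitzan's Lemma 11 (elongated-box hittability at one bounded scale) from BOX-CROSSING bounds and the uniqueness zone

builds on p205010 (kernel theorem, internal audit signed; external expert review pending)

Cell `prim-quant` (post-continuity programme, LANE 1, EXPLICIT-RATE PROGRAMME = LADDER R5), seat `prim-quant-p1`.  Composition of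
`Quant.elongHit_effective` (`…QuantLevelChainBounded.lean`, this seat) with the lead's `S4-sqrt` (`…QuantSqrtTrick.lean`): every crossing-type
input becomes a bound `1 − η ≤ P_p(boxCrossing d · ·)` on a BOUNDED window.  `--supports stmt-CriticalPhenomena-4575 --as helper`.  No definitions,
no sorries; standard axioms.

* `Quant.elongHit_of_boxCrossing` — for an aspect `K ≥ 2`, a direction `(a, σ)`, a scale `r` with `8(3K + 3KR₀ + k + n₁ + 8) ≤ r ≤ ℓhi` and a seed
  `Λ_m`, `m ≥ k`: the elongated box `{-r ≤ σ x_a ≤ Kr, |x_j| ≤ r}` is crossed from `Λ_m` to its far face with probability `> 1 − (δ' + (8K−4)·6δ)`, from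
  (w1) `1 − η ≤ P_p(boxCrossing d m' ℓ)` for `ℓ ∈ [ℓmax, ℓhi]` and `ℓ = M` with `η^{1/|HOct d|} < δ²` (inner target lemma, seed `Λ_{m'}`, `m' ≤ ℓmax`, `m' < M`),
  (w2) `1 − η' ≤ P_p(boxCrossing d k n)` for `n ∈ [n₁, r]` with `η'^{1/|HOct d|} < δ'` (`k ≤ n₁`), (c) `P_p(uniqZone m' M) > 1 − δ²`, (d) seeds
  `(1 − p^{seedBound d M})^{k'} ≤ δ`, (e) radius `R₀ ≥ 3M + ℓmax + 4 + ⌈(1−p)^{−2d·Ncont d M k'}/δ⌉`.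
This is the form in which the (Hit) input (aspect 6 at scale 3r), the hittability hypothesis of the (T) input (aspect 2K) and the `hhite` input
(aspect 88) of `Quant.corridor_of_boxCrossing` enter the window criterion `knCriterion` (S4, seat `prim-quant-p3`).
[cite: KozmaNitzan2024, §4 Lemma 11 (pp. 22–23); GrimmettPercolation1999, §7.2 (7.14)–(7.16)]
-/

noncomputable section

namespace Summit.CriticalPhenomena.PercolationContinuityZ3.Theorems.Quant

open MeasureTheory Literature.Probability.LatticeModels Literature.Probability.Percolation
  Literature.Probability.Percolation.KozmaNitzan
open Literature.Probability.Percolation.GM (HOct)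
open Summit.CriticalPhenomena.PercolationContinuityZ3.Theorems.SurfaceTension (boxCrossing)

variable {d : ℕ}

/-- **Kozma–Nitzan's Lemma 11 at one bounded scale from box-crossing bounds** (see the module docstring for the list of inputs).
[cite: KozmaNitzan2024, §4 Lemma 11 (pp. 22–23)] -/
theorem elongHit_of_boxCrossing [NeZero d] (p : unitInterval) (hp1 : (p : ℝ) < 1)
    {δ η η' δ' : ℝ} (hδ : 0 < δ) {m' M ℓmax ℓhi k' R₀ : ℕ} (hmM : m' < M) (hmℓ : m' ≤ ℓmax)
    (hη : η ^ ((Fintype.card (HOct d) : ℝ)⁻¹) < δ ^ 2)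
    (hwin : ∀ ℓ : ℕ, ℓmax ≤ ℓ → ℓ ≤ ℓhi → 1 - η ≤ (bondPercolation (zdGraph d) p).real (boxCrossing d m' ℓ))
    (hwM : 1 - η ≤ (bondPercolation (zdGraph d) p).real (boxCrossing d m' M))
    (huniq : 1 - δ ^ 2 < (bondPercolation (zdGraph d) p).real (uniqZone m' M))
    (hk : (1 - (p : ℝ) ^ seedBound d M) ^ k' ≤ δ)
    (hR : 3 * M + ℓmax + 4 + ⌈(1 / (1 - (p : ℝ)) ^ (2 * d * LData.Ncont d M k')) / δ⌉₊ ≤ R₀)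
    (a : Fin d) (σ : ℤˣ) (K : ℕ) (hK : 2 ≤ K) {k n₁ r m : ℕ} (hkn : k ≤ n₁)
    (hη' : η' ^ ((Fintype.card (HOct d) : ℝ)⁻¹) < δ')
    (hwin' : ∀ n : ℕ, n₁ ≤ n → n ≤ r → 1 - η' ≤ (bondPercolation (zdGraph d) p).real (boxCrossing d k n))
    (hr : 8 * (3 * K + 3 * K * R₀ + k + n₁ + 8) ≤ r) (hℓhi : r ≤ ℓhi) (hm : k ≤ m) :
    1 - (δ' + (8 * K - 4 : ℕ) * (6 * δ)) < (bondPercolation (zdGraph d) p).real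
      (linkIn (↑((elongGeom a σ K (by omega)).Qset r 0)) (box d m) ((elongGeom a σ K (by omega)).Fset r 0)) := by
  have hhitq : ∀ g ∈ qfList d, ∀ ℓ : ℕ, ℓmax ≤ ℓ → ℓ ≤ ℓhi →
      1 - δ ^ 2 < (bondPercolation (zdGraph d) p).real (linkIn (↑(g.Qset ℓ 0)) (box d m') (g.Fset ℓ 0)) := by
    intro g hg ℓ h1 h2
    obtain ⟨x, -, rfl⟩ := List.mem_map.1 hg
    exact real_linkIn_qfGeom_gt_of_boxCrossing p (hmℓ.trans h1) (hwin ℓ h1 h2) hη x.1 x.2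
  have hface : ∀ (a' : Fin d) (τ : Fin d → ℤˣ),
      1 - δ ^ 2 < (bondPercolation (zdGraph d) p).real (linkEvent (box d m') (orthantFace a' τ M) M) :=
    fun a' τ => real_linkEvent_orthantFace_gt_of_boxCrossing p hmM.le hwM hη a' τ
  have hlink : ∀ n : ℕ, n₁ ≤ n → n ≤ r → ∀ (a' : Fin d) (τ : Fin d → ℤˣ),
      1 - δ' < (bondPercolation (zdGraph d) p).real (linkEvent (box d k) (orthantFace a' τ n) n) :=
    fun n h1 h2 a' τ => real_linkEvent_orthantFace_gt_of_boxCrossing p (hkn.trans h1) (hwin' n h1 h2) hη' a' τ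
  exact elongHit_effective p hp1 hδ hmM hhitq hface huniq hk hR a σ K hK hlink hr hℓhi hm

end Summit.CriticalPhenomena.PercolationContinuityZ3.Theorems.Quant

end
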